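import Summits.AtomisticToContinuum.Crystallization.Theorems.FrustratedLawDichotomyStrainedPatchHomEntryLeafHTCross090A

/-!
# CROSSOVER CELL of the analytic-slab leaf at `0.9 t_b` (`U 2⁻¹²`), part B: the matrix-shifted curvature certificate and the chunked slope certificate

decomp-a2c hand-1 g31 (crux `AperiodicFrustratedLawGap`, stmt-AtomisticToContinuum-27623).  See `…Cross090A` for the cell `cX90 × wX` and the certificate `pX90`.
Kernel facts: `curvCheckLJM_X90` (`DX`-shifted centred LJ force-Jacobian certificate on the near labels at floor `1.32·SC`), `slope_near_X90`, `slope_far1_X90`,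
`slope_far2_X90` (naive guards + `htGs ≤ 1222·10⁹ / 7.5·10⁹ / 1.2·10⁹`; sum `≤ pX90.Gs = 1232·10⁹`), and the assembly `htCertSide_X90` (every certificate
conjunct of the slab leaf, by rewriting — no long `decide`).

Kernel facts + assembly; 0 sorry; standard axioms.  `--supports stmt-AtomisticToContinuum-27623`.
-/

namespace Summit.AtomisticToContinuum.Crystallization.Theorems.FrustratedLawDichotomyStrainedPatchHomEntryLeafHT

open Literature.Analysis.ValidatedNumerics.Numerics
open Summit.AtomisticToContinuum.Crystallization.Theorems.FrustratedLawDichotomyStrainedPatchHomCurvLJ (curvCheckLJM)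
open Summit.AtomisticToContinuum.Crystallization.Theorems.FrustratedLawDichotomyStrainedPatchHomForceJacN (forceJacCheckN)
open Summit.AtomisticToContinuum.Crystallization.Theorems.FrustratedLawDichotomyStrainedPatchHomForceHcp (xiBallOK)
open Summit.AtomisticToContinuum.Crystallization.Theorems.FrustratedLawDichotomyStrainedPatchHomCertTree (CertTree treeOK)
open Summit.AtomisticToContinuum.Crystallization.Theorems.FrustratedLawDichotomyStrainedPatchHomEntryTable (muRec)
open Summit.AtomisticToContinuum.Crystallization.Theorems.FrustratedLawDichotomyStrainedPatchHomEntryFitHcpCentred (fitOKHD entryLeafOKHQD entryLeafOKHT4QD)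

/-- ★ KERNEL: the `DX`-shifted centred LJ force-Jacobian certificate on the near labels of the cell certifies the floor `1.32·SC`. -/
theorem curvCheckLJM_X90 : curvCheckLJM cX90 wX (htCen cX90 wX) (htNai cX90 wX) DX 371546969258066 = true := by
  decide +kernel

/-- ★ KERNEL: chunked slope, near chunk (350 labels): `htGs ≤ 1222·10⁹` (`0.00434·SC`). -/
theorem slope_near_X90 : (htNaiOK cX90 wX (htNear cX90 wX) && decide (htGs cX90 wX (htNear cX90 wX) ≤ 1222000000000)) = true := by
  decide +kernel

/-- ★ KERNEL: chunked slope, far chunk 1: `htGs ≤ 7.5·10⁹`. -/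
theorem slope_far1_X90 : (htNaiOK cX90 wX (htFar1 cX90 wX) && decide (htGs cX90 wX (htFar1 cX90 wX) ≤ 7500000000)) = true := by
  decide +kernel

/-- ★ KERNEL: chunked slope, far chunk 2: `htGs ≤ 1.2·10⁹`. -/
theorem slope_far2_X90 : (htNaiOK cX90 wX (htFar2 cX90 wX) && decide (htGs cX90 wX (htFar2 cX90 wX) ≤ 1200000000)) = true := by
  decide +kernel

/-- The three chunk slope constants sum below `pX90.Gs`. [arithmetic on the kernel facts] -/
theorem htGs_sum_X90 : decide (htGs cX90 wX (htNear cX90 wX) + htGs cX90 wX (htFar1 cX90 wX) + htGs cX90 wX (htFar2 cX90 wX) ≤ pX90.Gs) = true := by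
  have h1 := slope_near_X90
  have h2 := slope_far1_X90
  have h3 := slope_far2_X90
  simp only [Bool.and_eq_true, decide_eq_true_eq] at h1 h2 h3 ⊢
  have e : pX90.Gs = 1232000000000 := rfl
  rw [e]
  linarith [h1.2, h2.2, h3.2]

/-- ★★ Every certificate conjunct of the slab leaf holds on the crossover cell. [assembly by rewriting] -/
theorem htCertSide_X90 : htCertSide pX90 cX90 wX = true := by
  have h1 := slope_near_X90
  have h2 := slope_far1_X90
  have h3 := slope_far2_X90
  simp only [Bool.and_eq_true] at h1 h2 h3
  rw [htCertSide, show pX90.D = DX from rfl, show pX90.lam₁ = 371546969258066 from rfl, show pX90.lam₂ = -2814749767106 from rfl,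
    show pX90.lam₃ = -2814749767106 from rfl, xiBallOK_X90, htROK_X90, htCertOK_X90, curvCheckLJM_X90, far1_X90, far2_X90, h1.1, h2.1, h3.1, htGs_sum_X90]
  simp

end Summit.AtomisticToContinuum.Crystallization.Theorems.FrustratedLawDichotomyStrainedPatchHomEntryLeafHT
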